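import Literature.Barriers.NavierStokesRegularity.NavierStokesInequalitySwitching
import Literature.Analysis.FluidPDE.SpaceTimeRescaling
import HarnessLib

/-!
# Scheffer's switched field: switching times, rescaled pieces and the glued field

Barrier-catalogue support file for `NavierStokesRegularity` (D-0021), first file of the
discharge of the switching argument `Literature.Barriers.NavierStokesRegularity.IsNSIBlock.switching`
(Scheffer 1985, Lemma 2.3; W. S. Ożański, arXiv:1709.00602, §2 "Sketch of the proof of
Theorem 1"). It contains ONLY the objects of the construction and their elementary algebra;
the analysis (rescaling covariance of the Navier–Stokes inequality, energy and dissipation sums,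
the local energy inequality of the glued field via the gluing principle of
`NavierStokesInequalityGluing*.lean`, the singular point) is in the sibling files
`SchefferSwitched*.lean`.

## What is printed (Ożański 2017, §2, (2.3)–(2.4); Scheffer 1985, p. 56)

Given `T > 0`, `τ ∈ (0,1)`, `z` and a field `u` on `[0,T]`, with `Γ(x) = τx + z`:
`t₀ = 0`, `t_j = T Σ_{k<j} τ^{2k}`, `T₀ = lim t_j = T/(1-τ²)`, `u^{(0)} = u`,
`u^{(j)}(x,t) = τ^{-j} u(Γ^{-j}(x), τ^{-2j}(t - t_j))`, and
`𝔲(t) = u^{(j)}(t)` for `t ∈ [t_j, t_{j+1})`, `𝔲(t) = 0` for `t ≥ T₀`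
(Scheffer: `T_j = (Σ_{k<j} τ^{2k})T`, `u^{j}(x,t) = τ⁻¹u^{j-1}(τ⁻¹(x-a), τ⁻²(t-T_{j-1}))`,
`u = 0` for `t ≥ T_∞ = (1-τ²)⁻¹T`).

## Contents

Builds on the accepted `NavierStokesInequalitySwitching.lean` (public structure `IsNSIBlock`,
`switchTime T τ j = t_j`, `blowupTime T τ = T₀`, `blowupPoint τ z = x₀` and their algebra); the
fact `IsNSIBlock.switching` of `NavierStokesInequalitySingularSolutionsProofs.lean` (stated for a
module-private copy of the structure) follows from `NSISwitching` by the accepted bridge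
`isNSIBlock_switching_of_nsiSwitching`, so everything here is phrased for the public objects.

* complements on the switching times: `t_j ≥ 0`, `T₀ - t_j = τ^{2j}T₀`, the local time
  `τ^{-2j}(t - t_j) ∈ [0,T)` of the `j`-th piece, the open slab of smoothness of a piece, and the
  partition of `[0, T₀)` into the pieces `[t_j, t_{j+1})` (existence and uniqueness of the piece
  index, `iUnion_Ico_switchTime`, pairwise disjointness);
* the fixed point `x₀ = z/(1-τ)` of `Γ(x) = τx + z` and the iterates `Γ^{±j}(x) = x₀ + τ^{±j}(x - x₀)`
  (generic in the space `E`);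
* `Scheffer.piece T τ z u j = u^{(j)}` (time first), realised as the tree's affine pull-back
  `τ^{-j} • Fluid.stPull τ^{-2j} τ^{-j} (-τ^{-2j}t_j) ((1-τ^{-j})x₀) u` so that the chain rules of
  `FluidPDE/SpaceTimeRescaling` apply verbatim; `piece_apply`, `piece_zero : u^{(0)} = u`, the
  values at the two ends of its life span (`piece_apply_switchTime`,
  `piece_apply_switchTime_succ`), and the slice in the form `x ↦ α • v(x₁ + γ • x)` of the
  affine-covariance lemmas (`piece_slice_eq_smul_comp_affine`);
* `Scheffer.glue T τ z u = 𝔲` (zero for `t < 0` as well, where nothing is required of it), with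
  `glue_eq_piece`, `glue_eq_of_mem_Ico : 𝔲 = u on [0,T)`, `glue_eq_zero_of_le : 𝔲 = 0 on [T₀,∞)`.

## References

* W. S. Ożański, *On weak solutions to the Navier–Stokes inequality with internal
  singularities*, arXiv:1709.00602 (2017), §2 (2.3)–(2.4). [`Ozanski2017NSISingular`]
* V. Scheffer, *A solution to the Navier–Stokes inequality with an internal singularity*,
  Comm. Math. Phys. 101 (1985), 47–85, proof of Lemma 2.3 (p. 56). [`Scheffer1985`]
-/

noncomputable section

open Set Function Filter
open scoped Topology

namespace Literature.Barriers.NavierStokesRegularity.Scheffer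

/-! ### Switching times: complements to `NavierStokesInequalitySwitching` -/

section Time

/-- `T₀ - t_j = τ^{2j} T₀`: the remaining life span shrinks geometrically. [folklore] -/
theorem blowupTime_sub_switchTime (T : ℝ) {τ : ℝ} (hτ : τ ^ 2 ≠ 1) (j : ℕ) :
    blowupTime T τ - switchTime T τ j = τ ^ (2 * j) * blowupTime T τ := by
  have h1 : (1 : ℝ) - τ ^ 2 ≠ 0 := sub_ne_zero.2 (Ne.symm hτ)
  rw [switchTime_eq T hτ, blowupTime]
  field_simp
  ring

/-- The switching times are nonnegative (`T > 0`, `τ > 0`). [folklore] -/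
theorem switchTime_nonneg {T τ : ℝ} (hT : 0 < T) (hτ : 0 < τ) (j : ℕ) : 0 ≤ switchTime T τ j := by
  simpa using (strictMono_switchTime hT hτ).monotone (Nat.zero_le j)

/-- **Every time in `[0, T₀)` lies in some piece `[t_j, t_{j+1})`.** [cite: Ozanski2017NSISingular, §2 (2.4)] -/
theorem exists_mem_Ico_switchTime {T τ : ℝ} (hτ₀ : 0 < τ) (hτ₁ : τ < 1) {t : ℝ} (ht₀ : 0 ≤ t)
    (ht : t < blowupTime T τ) :
    ∃ j : ℕ, t ∈ Ico (switchTime T τ j) (switchTime T τ (j + 1)) := by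
  classical
  have hev : ∃ j : ℕ, t < switchTime T τ j :=
    (((tendsto_switchTime hτ₀.le hτ₁).eventually (lt_mem_nhds ht))).exists
  set j := Nat.find hev with hj
  have hjt : t < switchTime T τ j := Nat.find_spec hev
  have hj0 : j ≠ 0 := by
    intro h0
    rw [h0, switchTime_zero] at hjt
    exact absurd hjt (not_lt.2 ht₀)
  obtain ⟨i, hi⟩ := Nat.exists_eq_succ_of_ne_zero hj0
  refine ⟨i, ?_, by simpa [hi] using hjt⟩
  have := Nat.find_min hev (show i < Nat.find hev by rw [← hj, hi]; exact Nat.lt_succ_self i)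
  exact not_lt.1 this

/-- **The piece index is unique** (the pieces `[t_j, t_{j+1})` are pairwise disjoint). [folklore] -/
theorem eq_of_mem_Ico_switchTime {T τ : ℝ} (hT : 0 < T) (hτ : 0 < τ) {t : ℝ} {j k : ℕ}
    (hj : t ∈ Ico (switchTime T τ j) (switchTime T τ (j + 1)))
    (hk : t ∈ Ico (switchTime T τ k) (switchTime T τ (k + 1))) : j = k := by
  have hmono := (strictMono_switchTime hT hτ).monotone
  by_contra hne
  rcases Nat.lt_or_gt_of_ne hne with h | h
  · exact absurd (hj.2.trans_le ((hmono (Nat.succ_le_of_lt h)).trans hk.1)) (lt_irrefl t)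
  · exact absurd (hk.2.trans_le ((hmono (Nat.succ_le_of_lt h)).trans hj.1)) (lt_irrefl t)

/-- The pieces are pairwise disjoint. [folklore] -/
theorem pairwise_disjoint_Ico_switchTime {T τ : ℝ} (hT : 0 < T) (hτ : 0 < τ) :
    Pairwise (Disjoint on fun j => Ico (switchTime T τ j) (switchTime T τ (j + 1))) := by
  intro j k hjk
  refine disjoint_left.2 fun t htj htk => hjk ?_
  exact eq_of_mem_Ico_switchTime hT hτ htj htk

/-- **The pieces partition `[0, T₀)`**: `⋃ⱼ [t_j, t_{j+1}) = [0, T₀)`. [cite: Ozanski2017NSISingular, §2 (2.4)] -/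
theorem iUnion_Ico_switchTime {T τ : ℝ} (hT : 0 < T) (hτ₀ : 0 < τ) (hτ₁ : τ < 1) :
    ⋃ j : ℕ, Ico (switchTime T τ j) (switchTime T τ (j + 1)) = Ico 0 (blowupTime T τ) := by
  ext t
  simp only [mem_iUnion, mem_Ico]
  constructor
  · rintro ⟨j, hj, hj'⟩
    exact ⟨(switchTime_nonneg hT hτ₀ j).trans hj,
      hj'.trans (switchTime_lt_blowupTime hT hτ₀ hτ₁ (j + 1))⟩
  · rintro ⟨h₀, h₁⟩
    exact exists_mem_Ico_switchTime hτ₀ hτ₁ h₀ h₁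

/-- A time in a piece is nonnegative and below the blow-up time. [folklore] -/
theorem mem_Ico_of_mem_Ico_switchTime {T τ : ℝ} (hT : 0 < T) (hτ₀ : 0 < τ) (hτ₁ : τ < 1)
    {t : ℝ} {j : ℕ} (hj : t ∈ Ico (switchTime T τ j) (switchTime T τ (j + 1))) :
    t ∈ Ico 0 (blowupTime T τ) := by
  rw [← iUnion_Ico_switchTime hT hτ₀ hτ₁]
  exact mem_iUnion.2 ⟨j, hj⟩

/-- The local time `τ^{-2j}(t - t_j)` of the `j`-th piece runs through `[0, T)` as `t` runs
through `[t_j, t_{j+1})`. [cite: Ozanski2017NSISingular, §2 (2.4)] -/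
theorem localTime_mem_Ico {T τ : ℝ} (hτ : 0 < τ) {t : ℝ} {j : ℕ}
    (hj : t ∈ Ico (switchTime T τ j) (switchTime T τ (j + 1))) :
    (τ⁻¹) ^ (2 * j) * (t - switchTime T τ j) ∈ Ico 0 T := by
  have hpos : 0 < (τ⁻¹) ^ (2 * j) := pow_pos (inv_pos.2 hτ) _
  have hinv : (τ⁻¹) ^ (2 * j) * τ ^ (2 * j) = 1 := by
    rw [inv_pow, inv_mul_cancel₀ (pow_ne_zero _ hτ.ne')]
  refine ⟨mul_nonneg hpos.le (sub_nonneg.2 hj.1), ?_⟩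
  have h2 := hj.2
  rw [switchTime_succ] at h2
  calc (τ⁻¹) ^ (2 * j) * (t - switchTime T τ j)
      < (τ⁻¹) ^ (2 * j) * (T * τ ^ (2 * j)) := mul_lt_mul_of_pos_left (by linarith) hpos
    _ = T := by rw [mul_comm T, ← mul_assoc, hinv, one_mul]

/-- The local time of the `j`-th piece runs through `[0, T]` as `t` runs through `[t_j, t_{j+1}]`. [folklore] -/
theorem localTime_mem_Icc {T τ : ℝ} (hτ : 0 < τ) {t : ℝ} {j : ℕ}
    (hj : t ∈ Icc (switchTime T τ j) (switchTime T τ (j + 1))) :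
    (τ⁻¹) ^ (2 * j) * (t - switchTime T τ j) ∈ Icc 0 T := by
  have hpos : 0 < (τ⁻¹) ^ (2 * j) := pow_pos (inv_pos.2 hτ) _
  have hinv : (τ⁻¹) ^ (2 * j) * τ ^ (2 * j) = 1 := by
    rw [inv_pow, inv_mul_cancel₀ (pow_ne_zero _ hτ.ne')]
  refine ⟨mul_nonneg hpos.le (sub_nonneg.2 hj.1), ?_⟩
  have h2 := hj.2
  rw [switchTime_succ] at h2
  calc (τ⁻¹) ^ (2 * j) * (t - switchTime T τ j)
      ≤ (τ⁻¹) ^ (2 * j) * (T * τ ^ (2 * j)) := mul_le_mul_of_nonneg_left (by linarith) hpos.le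
    _ = T := by rw [mul_comm T, ← mul_assoc, hinv, one_mul]

/-- Conversely, local times `s ∈ [0, T]` correspond to `t = t_j + τ^{2j}s ∈ [t_j, t_{j+1}]`. [folklore] -/
theorem switchTime_add_mem_Icc {T τ : ℝ} (hτ : 0 < τ) {s : ℝ} (hs : s ∈ Icc 0 T) (j : ℕ) :
    switchTime T τ j + τ ^ (2 * j) * s ∈ Icc (switchTime T τ j) (switchTime T τ (j + 1)) := by
  have hpos : 0 < τ ^ (2 * j) := pow_pos hτ _
  refine ⟨le_add_of_nonneg_right (mul_nonneg hpos.le hs.1), ?_⟩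
  rw [switchTime_succ]
  nlinarith [hs.2]

/-- The slab of times at which the `j`-th piece is smooth: local times in `(-η, T + η)`
correspond to `t ∈ (t_j - τ^{2j}η, t_{j+1} + τ^{2j}η)`, an open interval containing
`[t_j, t_{j+1}]`. [folklore] -/
theorem Icc_switchTime_subset_preimage {T τ η : ℝ} (hτ : 0 < τ) (hη : 0 < η) (j : ℕ) :
    Icc (switchTime T τ j) (switchTime T τ (j + 1)) ⊆
      (fun r => -((τ⁻¹) ^ (2 * j) * switchTime T τ j) + (τ⁻¹) ^ (2 * j) * r) ⁻¹' Ioo (-η) (T + η) := by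
  intro t ht
  have h := localTime_mem_Icc (T := T) hτ ht
  simp only [mem_preimage, mem_Ioo]
  have e : -((τ⁻¹) ^ (2 * j) * switchTime T τ j) + (τ⁻¹) ^ (2 * j) * t =
      (τ⁻¹) ^ (2 * j) * (t - switchTime T τ j) := by ring
  rw [e]
  exact ⟨by linarith [h.1], by linarith [h.2]⟩

end Time

/-! ### The similarity `Γ(x) = τx + z` and its centre -/

section Similarity

variable {E : Type*} [AddCommGroup E] [Module ℝ E]

/-- `x₀ = z/(1-τ)` is the fixed point of `Γ(x) = τx + z` (`τ ≠ 1`). [cite: Ozanski2017NSISingular, §2 p. 6] -/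
theorem smul_center_add {τ : ℝ} (hτ : τ ≠ 1) (z : E) :
    τ • ((1 - τ)⁻¹ • z) + z = (1 - τ)⁻¹ • z := by
  have h1 : (1 : ℝ) - τ ≠ 0 := sub_ne_zero.2 (Ne.symm hτ)
  rw [smul_smul]
  have : τ * (1 - τ)⁻¹ = (1 - τ)⁻¹ - 1 := by field_simp; ring
  rw [this, sub_smul, one_smul, sub_add_cancel]

/-- `Γ(x) = x₀ + τ(x - x₀)`: the similarity contracts towards its centre. [folklore] -/
theorem similarity_eq {τ : ℝ} (hτ : τ ≠ 1) (z x : E) :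
    τ • x + z = (1 - τ)⁻¹ • z + τ • (x - (1 - τ)⁻¹ • z) := by
  have h := smul_center_add hτ z
  rw [smul_sub]
  conv_rhs => enter [1]; rw [← h]
  abel

/-- Iterates: `Γʲ(x) = x₀ + τʲ(x - x₀)`. [folklore] -/
theorem similarity_iterate_eq {τ : ℝ} (hτ : τ ≠ 1) (z x : E) (j : ℕ) :
    (fun y : E => τ • y + z)^[j] x = (1 - τ)⁻¹ • z + τ ^ j • (x - (1 - τ)⁻¹ • z) := by
  induction j with
  | zero => simp
  | succ j ih =>
    rw [Function.iterate_succ_apply', ih, similarity_eq hτ z, add_sub_cancel_left, smul_smul,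
      pow_succ, mul_comm]

/-- The inverse iterate undoes the iterate: `Γʲ(x₀ + τ⁻ʲ(x - x₀)) = x`. [folklore] -/
theorem similarity_iterate_inv {τ : ℝ} (hτ₀ : τ ≠ 0) (hτ : τ ≠ 1) (z x : E) (j : ℕ) :
    (fun y : E => τ • y + z)^[j] ((1 - τ)⁻¹ • z + (τ⁻¹) ^ j • (x - (1 - τ)⁻¹ • z)) = x := by
  rw [similarity_iterate_eq hτ, add_sub_cancel_left, smul_smul, ← mul_pow,
    mul_inv_cancel₀ hτ₀, one_pow, one_smul, add_sub_cancel]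

/-- `x₀ + τ⁻ʲ(Γʲ(x) - x₀) = x`. [folklore] -/
theorem inv_similarity_iterate {τ : ℝ} (hτ₀ : τ ≠ 0) (hτ : τ ≠ 1) (z x : E) (j : ℕ) :
    (1 - τ)⁻¹ • z + (τ⁻¹) ^ j • ((fun y : E => τ • y + z)^[j] x - (1 - τ)⁻¹ • z) = x := by
  rw [similarity_iterate_eq hτ, add_sub_cancel_left, smul_smul, ← mul_pow,
    inv_mul_cancel₀ hτ₀, one_pow, one_smul, add_sub_cancel]

end Similarity

/-! ### The rescaled pieces and the glued field -/

section Field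

open Literature.Analysis.FluidPDE

variable {E : Type*} [NormedAddCommGroup E] [InnerProductSpace ℝ E]

/-- **The `j`-th rescaled piece** `u^{(j)}(t, x) = τ^{-j} u(τ^{-2j}(t - t_j), Γ^{-j}(x))`,
`Γ^{-j}(x) = x₀ + τ^{-j}(x - x₀)`, `x₀ = z/(1-τ)` (time first), written as the affine pull-back
`τ^{-j} • stPull τ^{-2j} τ^{-j} (-τ^{-2j} t_j) ((1 - τ^{-j}) x₀) u` of `FluidPDE/SpaceTimeRescaling`.
[cite: Ozanski2017NSISingular, §2 (2.4)] [cite: Scheffer1985, proof of Lemma 2.3 (p. 56)] -/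
def piece (T τ : ℝ) (z : E) (u : ℝ → E → E) (j : ℕ) : ℝ → E → E :=
  (τ⁻¹) ^ j • stPull ((τ⁻¹) ^ (2 * j)) ((τ⁻¹) ^ j) (-((τ⁻¹) ^ (2 * j) * switchTime T τ j))
    ((1 - (τ⁻¹) ^ j) • (1 - τ)⁻¹ • z) u

/-- Pointwise formula `u^{(j)}(t, x) = τ^{-j} u(τ^{-2j}(t - t_j), x₀ + τ^{-j}(x - x₀))`.
[cite: Ozanski2017NSISingular, §2 (2.4)] -/
theorem piece_apply (T τ : ℝ) (z : E) (u : ℝ → E → E) (j : ℕ) (t : ℝ) (x : E) :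
    piece T τ z u j t x = (τ⁻¹) ^ j •
      u ((τ⁻¹) ^ (2 * j) * (t - switchTime T τ j))
        ((1 - τ)⁻¹ • z + (τ⁻¹) ^ j • (x - (1 - τ)⁻¹ • z)) := by
  rw [piece, smul_stPull_apply]
  congr 2
  · ring
  · rw [smul_sub, sub_smul, one_smul, smul_comm ((τ⁻¹) ^ j) ((1 - τ)⁻¹) z]
    abel

/-- `u^{(0)} = u`. [cite: Ozanski2017NSISingular, §2] -/
@[simp]
theorem piece_zero (T τ : ℝ) (z : E) (u : ℝ → E → E) : piece T τ z u 0 = u := by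
  funext t x
  rw [piece_apply]
  simp

/-- The `j`-th piece along the `j`-th iterate of the similarity:
`u^{(j)}(t, Γʲ(y)) = τ^{-j} u(τ^{-2j}(t - t_j), y)`. [cite: Ozanski2017NSISingular, §2 (2.4)] -/
theorem piece_apply_similarity_iterate {T τ : ℝ} (hτ₀ : τ ≠ 0) (hτ : τ ≠ 1) (z : E)
    (u : ℝ → E → E) (j : ℕ) (t : ℝ) (y : E) :
    piece T τ z u j t ((fun w : E => τ • w + z)^[j] y) =
      (τ⁻¹) ^ j • u ((τ⁻¹) ^ (2 * j) * (t - switchTime T τ j)) y := by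
  rw [piece_apply, inv_similarity_iterate hτ₀ hτ]

/-- At the START of its life span the `j`-th piece is `u^{(j)}(t_j, x) = τ^{-j} u(0, Γ^{-j}x)`. [folklore] -/
theorem piece_apply_switchTime (T τ : ℝ) (z : E) (u : ℝ → E → E) (j : ℕ) (x : E) :
    piece T τ z u j (switchTime T τ j) x =
      (τ⁻¹) ^ j • u 0 ((1 - τ)⁻¹ • z + (τ⁻¹) ^ j • (x - (1 - τ)⁻¹ • z)) := by
  rw [piece_apply, sub_self, mul_zero]

/-- At the END of its life span the `j`-th piece is `u^{(j)}(t_{j+1}, x) = τ^{-j} u(T, Γ^{-j}x)`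
(`τ ≠ 0`). [folklore] -/
theorem piece_apply_switchTime_succ (T : ℝ) {τ : ℝ} (hτ : τ ≠ 0) (z : E) (u : ℝ → E → E)
    (j : ℕ) (x : E) :
    piece T τ z u j (switchTime T τ (j + 1)) x =
      (τ⁻¹) ^ j • u T ((1 - τ)⁻¹ • z + (τ⁻¹) ^ j • (x - (1 - τ)⁻¹ • z)) := by
  have hinv : (τ⁻¹) ^ (2 * j) * τ ^ (2 * j) = 1 := by
    rw [inv_pow, inv_mul_cancel₀ (pow_ne_zero _ hτ)]
  rw [piece_apply, switchTime_succ, add_sub_cancel_left, mul_comm T, ← mul_assoc, hinv, one_mul]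

/-- The slice of the `j`-th piece at time `t` is the rescaled space pull-back of the slice of `u`
at the local time. [folklore] -/
theorem piece_slice (T τ : ℝ) (z : E) (u : ℝ → E → E) (j : ℕ) (t : ℝ) :
    piece T τ z u j t = fun x => (τ⁻¹) ^ j •
      u ((τ⁻¹) ^ (2 * j) * (t - switchTime T τ j))
        ((1 - τ)⁻¹ • z + (τ⁻¹) ^ j • (x - (1 - τ)⁻¹ • z)) :=
  funext (piece_apply T τ z u j t)

/-- The slice of the `j`-th piece as `x ↦ α • v(x₁ + γ • x)` with `v` the slice of `u` at the
local time, `α = γ = τ^{-j}`, `x₁ = (1 - τ^{-j}) x₀` (the form of the affine covariance lemmas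
`normalisedPressure_smul_comp_affine`, `integral_comp_space_affine`). [folklore] -/
theorem piece_slice_eq_smul_comp_affine (T τ : ℝ) (z : E) (u : ℝ → E → E) (j : ℕ) (t : ℝ) :
    piece T τ z u j t = fun x => (τ⁻¹) ^ j •
      u ((τ⁻¹) ^ (2 * j) * (t - switchTime T τ j))
        ((1 - (τ⁻¹) ^ j) • (1 - τ)⁻¹ • z + (τ⁻¹) ^ j • x) := by
  funext x
  rw [piece_apply]
  congr 2
  rw [smul_sub, sub_smul, one_smul, smul_comm ((τ⁻¹) ^ j) ((1 - τ)⁻¹) z]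
  abel

open Classical in
/-- **Scheffer's switched (glued) field** `𝔲`: `𝔲(t) = u^{(j)}(t)` for `t ∈ [t_j, t_{j+1})`
(`j ≥ 0`), `𝔲(t) = 0` for `t ≥ T₀ = T/(1-τ²)` — and, where nothing is required of it, `𝔲(t) = 0`
for `t < 0` as well. The piece index is selected by choice; it is unique
(`eq_of_mem_Ico_switchTime`), see `glue_eq_piece`.
[cite: Ozanski2017NSISingular, §2 (2.4)] [cite: Scheffer1985, proof of Lemma 2.3 (p. 56)] -/
def glue (T τ : ℝ) (z : E) (u : ℝ → E → E) : ℝ → E → E := fun t x =>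
  if h : ∃ j : ℕ, t ∈ Ico (switchTime T τ j) (switchTime T τ (j + 1)) then
    piece T τ z u h.choose t x
  else 0

/-- **On the `j`-th piece the glued field is `u^{(j)}`.** [cite: Ozanski2017NSISingular, §2 (2.4)] -/
theorem glue_eq_piece {T τ : ℝ} (hT : 0 < T) (hτ : 0 < τ) (z : E) (u : ℝ → E → E) {t : ℝ} {j : ℕ}
    (hj : t ∈ Ico (switchTime T τ j) (switchTime T τ (j + 1))) :
    glue T τ z u t = piece T τ z u j t := by
  funext x
  have h : ∃ j : ℕ, t ∈ Ico (switchTime T τ j) (switchTime T τ (j + 1)) := ⟨j, hj⟩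
  rw [glue, dif_pos h, eq_of_mem_Ico_switchTime hT hτ h.choose_spec hj]

/-- Outside `⋃ⱼ [t_j, t_{j+1})` the glued field vanishes. [folklore] -/
theorem glue_eq_zero_of_not_exists {T τ : ℝ} (z : E) (u : ℝ → E → E) {t : ℝ}
    (h : ¬ ∃ j : ℕ, t ∈ Ico (switchTime T τ j) (switchTime T τ (j + 1))) :
    glue T τ z u t = 0 := by
  funext x
  rw [glue, dif_neg h]
  rfl

/-- **From the blow-up time on the glued field vanishes**: `𝔲(t) = 0` for `t ≥ T₀ = T/(1-τ²)`.
[cite: Ozanski2017NSISingular, §2 (2.4)] -/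
theorem glue_eq_zero_of_le {T τ : ℝ} (hT : 0 < T) (hτ₀ : 0 < τ) (hτ₁ : τ < 1) (z : E)
    (u : ℝ → E → E) {t : ℝ} (ht : blowupTime T τ ≤ t) : glue T τ z u t = 0 := by
  refine glue_eq_zero_of_not_exists z u fun ⟨j, hj⟩ => ?_
  exact absurd (mem_Ico_of_mem_Ico_switchTime hT hτ₀ hτ₁ hj).2 (not_lt.2 ht)

/-- Before time `0` the glued field vanishes (a convention; nothing is required there). [folklore] -/
theorem glue_eq_zero_of_neg {T τ : ℝ} (hT : 0 < T) (hτ : 0 < τ) (z : E) (u : ℝ → E → E) {t : ℝ}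
    (ht : t < 0) : glue T τ z u t = 0 := by
  refine glue_eq_zero_of_not_exists z u fun ⟨j, hj⟩ => ?_
  exact absurd ((switchTime_nonneg hT hτ j).trans hj.1) (not_le.2 ht)

/-- **On `[0, T)` the glued field is the block itself**: `𝔲 = u^{(0)} = u`.
[cite: Ozanski2017NSISingular, §2 (2.4)] -/
theorem glue_eq_of_mem_Ico {T τ : ℝ} (hT : 0 < T) (hτ : 0 < τ) (z : E) (u : ℝ → E → E) {t : ℝ}
    (ht : t ∈ Ico 0 T) : glue T τ z u t = u t := by
  have hj : t ∈ Ico (switchTime T τ 0) (switchTime T τ (0 + 1)) := by simpa using ht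
  rw [glue_eq_piece hT hτ z u hj, piece_zero]

/-- The glued field at nonnegative times below `T₀`, piecewise. [folklore] -/
theorem glue_apply_of_mem_Ico {T τ : ℝ} (hT : 0 < T) (hτ : 0 < τ) (z : E) (u : ℝ → E → E)
    {t : ℝ} {j : ℕ} (hj : t ∈ Ico (switchTime T τ j) (switchTime T τ (j + 1))) (x : E) :
    glue T τ z u t x = (τ⁻¹) ^ j •
      u ((τ⁻¹) ^ (2 * j) * (t - switchTime T τ j))
        ((1 - τ)⁻¹ • z + (τ⁻¹) ^ j • (x - (1 - τ)⁻¹ • z)) := by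
  rw [glue_eq_piece hT hτ z u hj, piece_apply]

/-- **The glued field is supported in `[0, T₀) × E` in time**: if `𝔲(t, x) ≠ 0` then
`t ∈ [t_j, t_{j+1})` for some `j`. [folklore] -/
theorem exists_mem_Ico_of_glue_ne_zero {T τ : ℝ} (z : E) (u : ℝ → E → E) {t : ℝ} {x : E}
    (h : glue T τ z u t x ≠ 0) :
    ∃ j : ℕ, t ∈ Ico (switchTime T τ j) (switchTime T τ (j + 1)) := by
  by_contra hne
  exact h (by rw [glue_eq_zero_of_not_exists z u hne]; rfl)

end Field

end Literature.Barriers.NavierStokesRegularity.Scheffer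

end
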